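import Summits.NavierStokesRegularity.NavierStokesRegularity.Theses.FilamentSkeletonRss
import Summits.NavierStokesRegularity.NavierStokesRegularity.Theorems.FilamentSkeletonRssSkeletonJ1GStubNormalBlock

/-!
# `NormalBlockMatched` (child stmt-NavierStokesRegularity-28312 of `SkeletonJ1G`, stmt-…-27849) — CLOSER BY NAME

The lane's landed theorem `Theorems.SkeletonJ1GStubNormalBlock.stub_normalBlock` (p647414, ACCEPTED 2026-08-28T16:13:56Z) states the
route child `Theses.FilamentSkeletonRss.NormalBlockMatched` with `FlatJ1G` / `NearStraightJ1G` / `Clause12J1G` unfolded verbatim; the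
route decl is the same term by `Iff.rfl`, so the item closes by the definitional re-statement below.  The theorem is NAMED
`stub_normalBlock` so that it also closes the registered stub of the skeleton of record (near_straight_newton.lean v4, sha16
24dc7fe3d1f8ceb4, registered 16:07:40Z: `stub_normalBlock : …Theses.FilamentSkeletonRss.NormalBlockMatched`).
Candidate closing proof prepared by the tenure planner (planner-ns-filament-repair-plan-g17-0); to be landed by a prover
`--workitem stmt-NavierStokesRegularity-28312`.  HONEST FRAMING: bookkeeping about a HYPOTHETICAL filament skeleton on the NEGATIVE
side of a MODEL route; `SkeletonJ1G` stays OPEN (children 28295 / 28296 open); nothing here bears on Navier–Stokes regularity.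
-/

set_option linter.dupNamespace false

namespace Summit.NavierStokesRegularity.NavierStokesRegularity.Theorems.FilamentSkeletonRssNormalBlockMatched

/-- Child 28312 `NormalBlockMatched` of the split of `SkeletonJ1G`, BY NAME (definitional unfolding of p647414's theorem). -/
theorem stub_normalBlock :
    Summit.NavierStokesRegularity.NavierStokesRegularity.Theses.FilamentSkeletonRss.NormalBlockMatched :=
  Summit.NavierStokesRegularity.NavierStokesRegularity.Theorems.SkeletonJ1GStubNormalBlock.stub_normalBlock

/-- The same fact under the route's `_holds` naming convention. -/
theorem normalBlockMatched_holds :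
    Summit.NavierStokesRegularity.NavierStokesRegularity.Theses.FilamentSkeletonRss.NormalBlockMatched :=
  stub_normalBlock

end Summit.NavierStokesRegularity.NavierStokesRegularity.Theorems.FilamentSkeletonRssNormalBlockMatched
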